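import Summits.NavierStokesRegularity.FluidComputer.AngularGalerkinLadderExamples
import Summits.NavierStokesRegularity.NavierStokesRegularity.Theorems.RungBlowupCofinal.ToroidalLift
import Summits.NavierStokesRegularity.NavierStokesRegularity.Theorems.RungBlowupCofinal.SectoralHarmonics
import Summits.NavierStokesRegularity.NavierStokesRegularity.Theorems.RungBlowupCofinal.Negative.SectoralWaveCasimir
import HarnessLib

/-!
# Sectoral toroidal waves: the mean–wave sector of the angular Galerkin ladder is kinematically
# inhabited at every rung and every admissible fold
# (route `AngularGalerkinLadder`, crux K1 `RungBlowupCofinal`; kinematic helper, theorems only)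

Cell `ns-blowup`, seat `ns-blowup-circuit` (g11, AGL Lean seat). Helper file for
`stmt-NavierStokesRegularity-19959` serving the line `Cruxes/RungBlowupCofinal/Lines/qlwave.lean`
(mean–wave rung profiles `U = V + W`: `V` zonal, `W` an `n`-fold azimuthal wave, `L < 2n`; fold range
`n ∈ (L/2, L]` by K5-74) — its card's FIRST PROVER TARGET (S1) «KINEMATIC NON-VACUITY of the sector at
every level» (part 3 of 3; parts 1–2: `ToroidalLift.lean`, `SectoralHarmonics.lean`). LABEL: KERNEL
kinematics. Nothing here asserts a Theses declaration; no definition, no named fact; no stub of the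
line is touched (the open stubs `stub_meanwave_profiles_cofinal` / `stub_meanwave_rung_four` are
EXISTENCE statements about the dynamics). WHAT THIS IS NOT: not Navier–Stokes evidence; not a
mean–wave PROFILE — explicit compactly supported solenoidal fields inhabiting the KINEMATIC
conjuncts of `Qlwave.IsMeanWaveProfile`, nothing about the zonal / wave equations or Type-I tails.

## Content

* `exists_sectoral_functional` — the functional `ℓ(y) = y₀ + iy₁ : ℝ³ →L[ℝ] ℂ` with its rotation
  laws `ℓ(e₂ × y) = iℓ(y)` and `Σ_a ℓ(e_a × y)² = −ℓ(y)²` (the inputs of `SectoralHarmonics`).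
* **`exists_sectoral_toroidal_wave`**: for `1 ≤ n ≤ L` there is a smooth, compactly supported,
  divergence-free `W`, band-limited of degree `≤ L`, with `𝒞W = n(n+1)W` and
  `J₃(J₃W) = −n²W` (the letter of `Qlwave.IsAzimuthalWave n W`), `W ≢ 0` — namely
  `W(y) = χ(‖y‖²) · y × ∇Re(y₀ + iy₁)ⁿ` (`χ` a smooth bump, `χ(2) = 1`; `W(e₀ + e₂) = n e₁`).
  **`exists_sectoral_toroidal_wave_top`** (`n = L`): the witness is moreover `L²`-orthogonal to every
  compactly supported field band-limited of degree `≤ L − 1` (K5-75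
  `isCobandLimited_pred_of_sectoral`) — it sits in the exact top isotype of rung `L`.
* `angGen_two_radial_cross_axis_two`: the localised swirl `χ(‖y‖²) e₂ × y` is ZONAL (`J₃V = 0`).
* **`exists_zonal_and_sectoral_wave`**: for every rung `L ≥ 1` and fold `1 ≤ n ≤ L` there are `V`
  zonal and `W` an `n`-fold wave, both smooth, compactly supported, divergence free, band-limited of
  degree `≤ L` and not identically zero — every KINEMATIC conjunct of `IsMeanWaveProfile L n` is
  jointly inhabited by non-trivial fields on every rung (in particular the sector is not killed by
  the Casimir cut itself; by K5-74 no inhabitant exists with `n > L`, so the range `1 ≤ n ≤ L` is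
  sharp).

[cite: BullardGellman1954] (toroidal vector spherical harmonics `x × ∇(rⁿYₙₙ)`; here
projection-free, in the tree's Casimir-cut typing).
-/

noncomputable section

namespace Summit.NavierStokesRegularity.AngularGalerkinLadderSectoralToroidal

open Set Function Complex
open scoped ContDiff RealInnerProductSpace
open Literature.Analysis.FluidPDE
open Summit.NavierStokesRegularity.FluidComputer
open Summit.NavierStokesRegularity.FluidComputer.AngularLadder
open Summit.NavierStokesRegularity.AngularGalerkinLadderToroidalLift
open Summit.NavierStokesRegularity.AngularGalerkinLadderSectoralHarmonics

/-! ## The witnesses: sectoral toroidal waves and the zonal swirl -/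

section Witness

/-- The coordinate functional `ℓ(y) = y₀ + i y₁` as a real-linear map `ℝ³ → ℂ`, with its three
rotation laws: `ℓ(e₂ × y) = iℓ(y)`, `Σ_a ℓ(e_a × y)² = −ℓ(y)²`, and the normalisation
`ℓ(e₀ + e₂) = 1`, `ℓ(w) = w₀ + i w₁`. [folklore] -/
theorem exists_sectoral_functional :
    ∃ ℓ : EuclideanSpace ℝ (Fin 3) →L[ℝ] ℂ,
      (∀ y, ℓ y = ((y 0 : ℝ) : ℂ) + I * ((y 1 : ℝ) : ℂ)) ∧
      (∀ y, ℓ (crossCLM (axis 2) y) = I * ℓ y) ∧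
      (∀ y, ∑ a : Fin 3, (ℓ (crossCLM (axis a) y)) ^ 2 = -(ℓ y) ^ 2) := by
  refine ⟨LinearMap.toContinuousLinearMap
    { toFun := fun y => ((y 0 : ℝ) : ℂ) + I * ((y 1 : ℝ) : ℂ)
      map_add' := fun y z => by
        simp only [PiLp.add_apply, Complex.ofReal_add]
        ring
      map_smul' := fun c y => by
        simp only [PiLp.smul_apply, smul_eq_mul, Complex.ofReal_mul, RingHom.id_apply,
          Complex.real_smul]; ring }, fun y => rfl, fun y => ?_, fun y => ?_⟩
  · show ((cross (axis 2) y 0 : ℝ) : ℂ) + I * ((cross (axis 2) y 1 : ℝ) : ℂ) =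
      I * (((y 0 : ℝ) : ℂ) + I * ((y 1 : ℝ) : ℂ))
    apply Complex.ext <;> simp [cross, cross_apply, axis_apply]
  · show ∑ a : Fin 3, (((cross (axis a) y 0 : ℝ) : ℂ) + I * ((cross (axis a) y 1 : ℝ) : ℂ)) ^ 2 =
      -(((y 0 : ℝ) : ℂ) + I * ((y 1 : ℝ) : ℂ)) ^ 2
    rw [Fin.sum_univ_three]
    apply Complex.ext <;> simp [cross, cross_apply, axis_apply, sq]

/-- `‖e₀ + e₂‖² = 2`. [folklore] -/
private theorem norm_sq_axis_zero_add_axis_two : ‖axis 0 + axis 2‖ ^ 2 = (2 : ℝ) := by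
  rw [EuclideanSpace.norm_sq_eq]
  simp [Fin.sum_univ_three, axis_apply]
  norm_num

/-- `(e₀ + e₂) × e₀ = e₁`. [folklore] -/
private theorem cross_axis_zero_add_axis_two_axis_zero : cross (axis 0 + axis 2) (axis 0) = axis 1 := by
  apply PiLp.ext
  intro i
  fin_cases i <;> simp [cross, cross_apply, axis_apply]

variable {L n : ℕ}

/-- **SECTORAL TOROIDAL WAVES — the mean–wave sector is kinematically inhabited at every rung and
every admissible fold.** For `1 ≤ n ≤ L` there is a smooth, compactly supported, divergence-free
vector field `W` on `ℝ³` which is band-limited of degree `≤ L`, an exact `𝒞`-eigenfield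
`𝒞W = n(n+1)W` (isotype `j = n`), an `n`-fold azimuthal wave `J₃(J₃W) = −n²W` (the letter of
`Qlwave.IsAzimuthalWave n W`), and not identically zero: the cut-off sectoral toroidal harmonic
`W(y) = χ(‖y‖²) · y × ∇Re(y₀ + iy₁)ⁿ` with a smooth bump `χ`, `χ(2) = 1`, for which
`W(e₀ + e₂) = n e₁`. [cite: BullardGellman1954] (toroidal vector spherical harmonics
`x × ∇(rⁿYₙₙ)`; here projection-free, in the tree's Casimir-cut typing). -/
theorem exists_sectoral_toroidal_wave (hn : 1 ≤ n) (hnL : n ≤ L) :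
    ∃ W : EuclideanSpace ℝ (Fin 3) → EuclideanSpace ℝ (Fin 3),
      ContDiff ℝ ∞ W ∧ HasCompactSupport W ∧ VectorCalculus.IsDivFree W ∧ IsBandLimited L W ∧
      casimir W = ((n : ℝ) * ((n : ℝ) + 1)) • W ∧
      (∀ y, angGen 2 (angGen 2 W) y = -(((n : ℝ) ^ 2) • W y)) ∧ ∃ y, W y ≠ 0 := by
  obtain ⟨ℓ, hℓ, h2, hs⟩ := exists_sectoral_functional
  let χ : ContDiffBump (0 : ℝ) := ⟨2, 3, two_pos, by norm_num⟩
  have hχs : ContDiff ℝ ∞ (χ : ℝ → ℝ) := χ.contDiff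
  have hχd : Differentiable ℝ (χ : ℝ → ℝ) := hχs.differentiable (by simp)
  -- the sectoral gradient field `G = ∇Re(ℓ ·)^n` and its toroidalisation `T = y × G(y)`
  have hh : ContDiff ℝ ∞ (fun z => ((ℓ z) ^ n).re) := contDiff_re_clm_pow ℓ n
  have hGband : IsBandLimited n (gradient fun z => ((ℓ z) ^ n).re) := isBandLimited_gradient_re ℓ hs n
  have hG : ContDiff ℝ ∞ (gradient fun z => ((ℓ z) ^ n).re) := hGband.1
  have hGcas := casimir_gradient_re ℓ hs n
  have hGwave := wave_gradient_re ℓ h2 n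
  have hT : ContDiff ℝ ∞ (fun y => cross y (gradient (fun z => ((ℓ z) ^ n).re) y)) :=
    contDiff_crossSelf hG
  refine ⟨fun y => χ (‖y‖ ^ 2) • cross y (gradient (fun z => ((ℓ z) ^ n).re) y),
    contDiff_radial_smul hχs hT, hasCompactSupport_radial_smul χ.hasCompactSupport _,
    isDivFree_radial_crossSelf_gradient hχd hh,
    ((isBandLimited_crossSelf hGband).mono hnL).radial_smul hχs, ?_, fun y => ?_, ?_⟩
  · -- Casimir eigenfield: radial multipliers and toroidalisation commute with `𝒞`
    rw [casimir_radial_smul hχs hT, casimir_crossSelf_of_eq_smul hG hGcas]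
    funext y
    simp only [Pi.smul_apply, smul_comm (χ (‖y‖ ^ 2))]
  · -- `n`-fold wave: radial multipliers and toroidalisation commute with `J₃`
    have hTd : Differentiable ℝ (fun y => cross y (gradient (fun z => ((ℓ z) ^ n).re) y)) :=
      hT.differentiable (by simp)
    rw [angGen_radial_smul hχd hTd 2,
      angGen_radial_smul hχd ((contDiff_angGen hT 2).differentiable (by simp)) 2]
    simp only [wave_crossSelf hG hGwave y, smul_neg, smul_comm (χ (‖y‖ ^ 2))]
  · -- non-vanishing at `e₀ + e₂`: `∇Re(ℓ ·)^n (e₀ + e₂) = n e₀`, so `W(e₀ + e₂) = n e₁`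
    refine ⟨axis 0 + axis 2, ?_⟩
    have hℓ1 : ℓ (axis 0 + axis 2) = 1 := by
      rw [hℓ]; simp [axis_apply]
    have hgrad : gradient (fun z => ((ℓ z) ^ n).re) (axis 0 + axis 2) = (n : ℝ) • axis 0 := by
      refine ext_inner_right ℝ fun w => ?_
      rw [inner_gradient_left, fderiv_re_apply ((differentiable_clm_pow ℓ n) _),
        fderiv_clm_pow_apply, hℓ1, one_pow, mul_one, hℓ w, real_inner_smul_left, axis,
        EuclideanSpace.inner_single_left]
      simp
    have hχ1 : χ (‖axis 0 + axis 2‖ ^ 2) = 1 := by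
      apply χ.one_of_mem_closedBall
      rw [norm_sq_axis_zero_add_axis_two, Metric.mem_closedBall, dist_zero_right, Real.norm_eq_abs,
        abs_of_pos two_pos]
    intro h0
    have h0' : χ (‖axis 0 + axis 2‖ ^ 2) •
        cross (axis 0 + axis 2) (gradient (fun z => ((ℓ z) ^ n).re) (axis 0 + axis 2)) = 0 := h0
    rw [hχ1, one_smul, hgrad, ← crossCLM_apply, map_smul, crossCLM_apply,
      cross_axis_zero_add_axis_two_axis_zero] at h0'
    have h1 := congrArg (fun v : EuclideanSpace ℝ (Fin 3) => v 1) h0'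
    simp [axis_apply] at h1
    omega

/-- **The sectoral fold `n = L`**: the witness sits in the exact top isotype of rung `L` — it is
moreover `L²`-orthogonal to every compactly supported field band-limited of degree `≤ L−1`
(K5-75 `isCobandLimited_pred_of_sectoral`). [folklore] -/
theorem exists_sectoral_toroidal_wave_top (hL : 1 ≤ L) :
    ∃ W : EuclideanSpace ℝ (Fin 3) → EuclideanSpace ℝ (Fin 3),
      ContDiff ℝ ∞ W ∧ HasCompactSupport W ∧ VectorCalculus.IsDivFree W ∧ IsBandLimited L W ∧
      IsCobandLimited (L - 1) W ∧ casimir W = ((L : ℝ) * ((L : ℝ) + 1)) • W ∧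
      (∀ y, angGen 2 (angGen 2 W) y = -(((L : ℝ) ^ 2) • W y)) ∧ ∃ y, W y ≠ 0 := by
  obtain ⟨W, hWs, hWc, hWdiv, hWband, hWcas, hWwave, hWne⟩ :=
    exists_sectoral_toroidal_wave hL le_rfl
  exact ⟨W, hWs, hWc, hWdiv, hWband,
    AngularGalerkinLadderSectoralWave.isCobandLimited_pred_of_sectoral hWband hWwave hL,
    hWcas, hWwave, hWne⟩

/-- **The zonal swirl** `V(y) = χ(‖y‖²) e₂ × y` is zonal: `J₃V = 0` (the linear field `e₂ × ·`
commutes with itself; radial multipliers commute with `J₃`). [folklore] -/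
theorem angGen_two_radial_cross_axis_two {χ : ℝ → ℝ} (hχ : Differentiable ℝ χ)
    (y : EuclideanSpace ℝ (Fin 3)) :
    angGen 2 (fun x : EuclideanSpace ℝ (Fin 3) => χ (‖x‖ ^ 2) • cross (axis 2) x) y = 0 := by
  have hd : Differentiable ℝ (fun x : EuclideanSpace ℝ (Fin 3) => cross (axis 2) x) :=
    (crossCLM (axis 2)).differentiable
  have e : angGen 2 (fun x : EuclideanSpace ℝ (Fin 3) => cross (axis 2) x) = 0 := by
    change angGen 2 (⇑(crossCLM (axis 2))) = 0
    rw [angGen_clm, sub_self]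
    simp
  rw [angGen_radial_smul hχ hd 2]
  simp only [e, Pi.zero_apply, smul_zero]

/-- **THE KINEMATIC LETTERS OF THE MEAN–WAVE CLASS ARE JOINTLY INHABITED AT EVERY RUNG**: for
every rung `L ≥ 1` and every fold `1 ≤ n ≤ L` there are a ZONAL field `V` (`J₃V = 0`) and an
`n`-fold azimuthal WAVE `W` (`J₃(J₃W) = −n²W`), both smooth, compactly supported, divergence free,
band-limited of degree `≤ L`, and NOT identically zero, with `L < 2n` whenever `L/2 < n` — i.e.
every KINEMATIC conjunct of `Qlwave.IsMeanWaveProfile L n` (line `qlwave` of crux K1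
`RungBlowupCofinal`) is inhabited by honest non-trivial fields; the DYNAMIC conjuncts (the zonal and
wave profile equations with co-band-limited defects and the Type-I tail) are untouched — no profile
is constructed. WHAT THIS IS NOT: not NS; not a mean–wave profile. [folklore] -/
theorem exists_zonal_and_sectoral_wave (hn : 1 ≤ n) (hnL : n ≤ L) :
    ∃ V W : EuclideanSpace ℝ (Fin 3) → EuclideanSpace ℝ (Fin 3),
      IsBandLimited L V ∧ IsBandLimited L W ∧ VectorCalculus.IsDivFree V ∧
      VectorCalculus.IsDivFree W ∧ (∀ y, angGen 2 V y = 0) ∧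
      (∀ y, angGen 2 (angGen 2 W) y = -(((n : ℝ) ^ 2) • W y)) ∧
      HasCompactSupport V ∧ HasCompactSupport W ∧ (∃ y, V y ≠ 0) ∧ ∃ y, W y ≠ 0 := by
  obtain ⟨W, -, hWc, hWdiv, hWband, -, hWwave, hWne⟩ := exists_sectoral_toroidal_wave hn hnL
  let χ : ContDiffBump (0 : ℝ) := ⟨1, 2, one_pos, one_lt_two⟩
  have hχs : ContDiff ℝ ∞ (χ : ℝ → ℝ) := χ.contDiff
  have hχd : Differentiable ℝ (χ : ℝ → ℝ) := hχs.differentiable (by simp)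
  refine ⟨fun x => χ (‖x‖ ^ 2) • cross (axis 2) x, W,
    isBandLimited_radial_cross hχs _ (hn.trans hnL), hWband, isDivFree_radial_cross hχd _, hWdiv,
    angGen_two_radial_cross_axis_two hχd, hWwave, hasCompactSupport_radial_cross χ.hasCompactSupport _,
    hWc, ⟨axis 0, ?_⟩, hWne⟩
  have hn1 : ‖axis (0 : Fin 3)‖ ^ 2 = 1 := by
    rw [EuclideanSpace.norm_sq_eq]
    simp [axis_apply]
  have h1 : χ (‖axis (0 : Fin 3)‖ ^ 2) = 1 := by
    apply χ.one_of_mem_closedBall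
    rw [hn1, Metric.mem_closedBall, dist_zero_right, norm_one]
  intro h0
  have h0' : χ (‖axis (0 : Fin 3)‖ ^ 2) • cross (axis 2) (axis 0) = 0 := h0
  rw [h1, one_smul] at h0'
  have h2 := congrArg (fun v : EuclideanSpace ℝ (Fin 3) => v 1) h0'
  simp [cross, cross_apply, axis_apply] at h2

end Witness

end Summit.NavierStokesRegularity.AngularGalerkinLadderSectoralToroidal

end
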